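import Summits.ResolutionOfSingularities.ResolutionOfSingularities.Theorems.FrobeniusLadderFInjectiveMacaulayficationChartModelNumerators
import HarnessLib

/-!
# [OURS · L1 W4.5a] E7 R3 data kit `ChartModelReadings` — numerator form of a model element under the GENERAL numerator relation
# `Σᵢ eᵢ·aᵢ + K·m = β + |e|·m` (no `|e| ≤ K`): the form needed to READ a Rees element of one chart in ANOTHER chart

Crux `FrobeniusLadder.FInjectiveMacaulayfication` = stmt-ResolutionOfSingularities-15315 (chain w45a), hole 5e, E7 T₁₁/3 instance, R3 DATA
HALF (res-L1-w45a-plan-1 R13.19, res-L1-w45a-lead-1 NAMING 13:16:28Z). Helper `--supports stmt-ResolutionOfSingularities-15315 --as helper`,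
typed by res-type-034. OURS: replaces the role of NOTHING in H. Hironaka's manuscript and is NOT a statement of it; AI-written kernel glue of
the cell `res-hironaka`, weaker than expert review. No definition, no named fact. Sequel of `ChartModelNumerators`.

WHY. `ChartModelNumerators.theta_mk_evalL_eq_reesChartEquiv` turns a y-term list `L` of the chart `D₊(x̄^m t)` into the numerator form
`(mk (evalL NL))/(x̄^m t)^K` under the PADDED relation `β = Σᵢ eᵢ·aᵢ + (K − |e|)·m`, which needs `|e| ≤ K`. Reading a Rees element
`x/(x̄^{m′} t)^K` of ANOTHER chart in the chart `D₊(x̄^m t)` (the `h1`/`h2` memberships of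
`AffineBlowupChartRestriction.map_ideal_closure_eq_of_memberships`) produces y-monomials of total degree `|e| > K` (T₁₁/3, chart 32 read
in chart 64: `|e| = 141`, `K = 3`). The right relation is the subtraction-free **`Σᵢ eᵢ·aᵢ + K·m = β + |e|·m`**:
* `psi_monomial_mul_pow_of_rel` — `Ψ(c·y^e) · (x̄^m/1)^K = (c·x̄^β)/1` under that relation;
* `psi_evalL_mul_pow_of_rel` — the same on term lists (`List.Forall₂`, decidable on literals);
* **`theta_mk_evalL_eq_reesChartEquiv_of_rel`** — `θ (mk (evalL L)) = reesChartEquiv x̄^m _ (Away.mk K ⟨(mk (evalL NL)) tᴷ, _⟩)` for a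
  C1-presented `θ` (`(θ q̄).val = Ψ q`), GIVEN `mk (evalL NL) ∈ I^K` (known from the element's own chart) — any ideal `I ∋ x̄^m`.
References: folklore.
-/

-- single-problem summit: the doubled namespace component is forced
set_option linter.dupNamespace false

noncomputable section

open MvPolynomial Literature.AlgebraicGeometry.Resolution
open Summit.ResolutionOfSingularities.ResolutionOfSingularities.Theorems.FInjectiveMacaulayfication

namespace Summit.ResolutionOfSingularities.ResolutionOfSingularities.Theorems.FInjectiveMacaulayfication.ChartModelReadings

variable {k : Type} [Field k] {n : ℕ} (f : MvPolynomial (Fin n) k) (m : Fin n →₀ ℕ) (a : Fin n → (Fin n →₀ ℕ))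

/-- **`Ψ` on one monomial under the general numerator relation** `Σᵢ eᵢ·aᵢ + K·m = β + |e|·m`:
`Ψ(c·y^e) · (x̄^m/1)^K = (c·x̄^β)/1` (from `ChartModelNumerators.psi_monomial_mul_pow` at height `|e|`, cancelling the unit
`(x̄^m/1)^{|e|}` of `R̄[1/x̄^m]`). [folklore] -/
theorem psi_monomial_mul_pow_of_rel (c : k) (e β : Fin n →₀ ℕ) (K : ℕ)
    (hrel : ∑ i : Fin n, e i • a i + K • m = β + (∑ i : Fin n, e i) • m) :
    aeval (fun i : Fin n => algebraMap (MvPolynomial (Fin n) k ⧸ Ideal.span {f})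
        (Localization.Away (Ideal.Quotient.mk (Ideal.span {f}) (monomial m (1 : k))))
        (Ideal.Quotient.mk (Ideal.span {f}) (monomial (a i) (1 : k))) *
      IsLocalization.Away.invSelf (Ideal.Quotient.mk (Ideal.span {f}) (monomial m (1 : k)))) (monomial e c) *
      (algebraMap (MvPolynomial (Fin n) k ⧸ Ideal.span {f})
        (Localization.Away (Ideal.Quotient.mk (Ideal.span {f}) (monomial m (1 : k))))
        (Ideal.Quotient.mk (Ideal.span {f}) (monomial m (1 : k)))) ^ K =
      algebraMap (MvPolynomial (Fin n) k ⧸ Ideal.span {f})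
        (Localization.Away (Ideal.Quotient.mk (Ideal.span {f}) (monomial m (1 : k))))
        (Ideal.Quotient.mk (Ideal.span {f}) (monomial β c)) := by
  have h0 := ChartModelNumerators.psi_monomial_mul_pow f m a c e (∑ i : Fin n, e i) le_rfl
  rw [Nat.sub_self, zero_smul, add_zero] at h0
  have hU : IsUnit (algebraMap (MvPolynomial (Fin n) k ⧸ Ideal.span {f})
      (Localization.Away (Ideal.Quotient.mk (Ideal.span {f}) (monomial m (1 : k))))
      (Ideal.Quotient.mk (Ideal.span {f}) (monomial m (1 : k))) ^ (∑ i : Fin n, e i)) :=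
    (IsLocalization.Away.algebraMap_isUnit (S := Localization.Away (Ideal.Quotient.mk (Ideal.span {f}) (monomial m (1 : k))))
      (Ideal.Quotient.mk (Ideal.span {f}) (monomial m (1 : k)))).pow _
  refine hU.mul_left_injective ?_
  have hpoly : (monomial (∑ i : Fin n, e i • a i) c : MvPolynomial (Fin n) k) * monomial m (1 : k) ^ K =
      monomial β c * monomial m (1 : k) ^ (∑ i : Fin n, e i) := by
    simp only [monomial_pow, monomial_mul, one_pow, mul_one]
    rw [hrel]
  have h1 := congrArg (fun q : MvPolynomial (Fin n) k => algebraMap (MvPolynomial (Fin n) k ⧸ Ideal.span {f})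
      (Localization.Away (Ideal.Quotient.mk (Ideal.span {f}) (monomial m (1 : k)))) (Ideal.Quotient.mk (Ideal.span {f}) q)) hpoly
  simp only [map_mul, map_pow] at h1
  simp only
  rw [mul_right_comm, h0, h1]

/-- **`Ψ` on a term list under the general relation**: if termwise `NL` has the coefficient of `L` and exponent `β` with
`Σᵢ eᵢ·(aᵢ)ⱼ + K·mⱼ = βⱼ + |e|·mⱼ` (a `decide`-able `List.Forall₂` relation), then `Ψ(evalL L) · (x̄^m/1)^K = (mk (evalL NL))/1`. [folklore] -/
theorem psi_evalL_mul_pow_of_rel (K : ℕ) :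
    ∀ (L NL : List (ℤ × (Fin n → ℕ))),
    List.Forall₂ (fun t s : ℤ × (Fin n → ℕ) => s.1 = t.1 ∧
      ∀ j : Fin n, (∑ i : Fin n, t.2 i * a i j) + K * m j = s.2 j + (∑ i : Fin n, t.2 i) * m j) L NL →
    aeval (fun i : Fin n => algebraMap (MvPolynomial (Fin n) k ⧸ Ideal.span {f})
        (Localization.Away (Ideal.Quotient.mk (Ideal.span {f}) (monomial m (1 : k))))
        (Ideal.Quotient.mk (Ideal.span {f}) (monomial (a i) (1 : k))) *
      IsLocalization.Away.invSelf (Ideal.Quotient.mk (Ideal.span {f}) (monomial m (1 : k))))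
        ((L.map fun t : ℤ × (Fin n → ℕ) =>
          (monomial (Finsupp.equivFunOnFinite.symm t.2) ((t.1 : ℤ) : k) : MvPolynomial (Fin n) k)).sum) *
      (algebraMap (MvPolynomial (Fin n) k ⧸ Ideal.span {f})
        (Localization.Away (Ideal.Quotient.mk (Ideal.span {f}) (monomial m (1 : k))))
        (Ideal.Quotient.mk (Ideal.span {f}) (monomial m (1 : k)))) ^ K =
      algebraMap (MvPolynomial (Fin n) k ⧸ Ideal.span {f})
        (Localization.Away (Ideal.Quotient.mk (Ideal.span {f}) (monomial m (1 : k))))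
        (Ideal.Quotient.mk (Ideal.span {f})
          ((NL.map fun t : ℤ × (Fin n → ℕ) =>
            (monomial (Finsupp.equivFunOnFinite.symm t.2) ((t.1 : ℤ) : k) : MvPolynomial (Fin n) k)).sum)) := by
  intro L NL h
  set Ψ := aeval (R := k) (fun i : Fin n => algebraMap (MvPolynomial (Fin n) k ⧸ Ideal.span {f})
      (Localization.Away (Ideal.Quotient.mk (Ideal.span {f}) (monomial m (1 : k))))
      (Ideal.Quotient.mk (Ideal.span {f}) (monomial (a i) (1 : k))) *
      IsLocalization.Away.invSelf (Ideal.Quotient.mk (Ideal.span {f}) (monomial m (1 : k)))) with hΨ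
  induction h with
  | nil => simp
  | @cons t s L NL hts _ ih =>
    obtain ⟨hcoef, hexp⟩ := hts
    have hrel : ∑ i : Fin n, (Finsupp.equivFunOnFinite.symm t.2 : Fin n →₀ ℕ) i • a i + K • m =
        (Finsupp.equivFunOnFinite.symm s.2 : Fin n →₀ ℕ) +
          (∑ i : Fin n, (Finsupp.equivFunOnFinite.symm t.2 : Fin n →₀ ℕ) i) • m := by
      ext j
      simp only [Finsupp.add_apply, Finsupp.smul_apply, Finsupp.finsetSum_apply, smul_eq_mul,
        Finsupp.coe_equivFunOnFinite_symm]
      exact hexp j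
    have key := psi_monomial_mul_pow_of_rel f m a ((t.1 : ℤ) : k) (Finsupp.equivFunOnFinite.symm t.2)
      (Finsupp.equivFunOnFinite.symm s.2) K hrel
    rw [← hΨ] at key
    have hadd : ∀ x y : MvPolynomial (Fin n) k, Ψ (x + y) = Ψ x + Ψ y := fun x y => Ψ.toRingHom.map_add x y
    rw [List.map_cons, List.sum_cons, List.map_cons, List.sum_cons, hadd, add_mul, ih, key, hcoef,
      (Ideal.Quotient.mk (Ideal.span {f})).map_add,
      (algebraMap (MvPolynomial (Fin n) k ⧸ Ideal.span {f})
        (Localization.Away (Ideal.Quotient.mk (Ideal.span {f}) (monomial m (1 : k))))).map_add]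

/-- **THE NUMERATOR FORM OF A MODEL ELEMENT, GENERAL RELATION.** For a C1-presented chart `θ : k[y]⧸(g) → R̄[I/x̄^m]`
(`(θ q̄).val = Ψ q`), any ideal `I ∋ x̄^m`, a y-term list `L` and an x-term list `NL` related at height `K` by the general
relation, and `mk (evalL NL) ∈ I^K`: `θ (mk (evalL L)) = reesChartEquiv x̄^m _ (Away.mk K ⟨(mk (evalL NL)) tᴷ, _⟩)`. [folklore] -/
theorem theta_mk_evalL_eq_reesChartEquiv_of_rel (I : Ideal (MvPolynomial (Fin n) k ⧸ Ideal.span {f}))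
    (hm : Ideal.Quotient.mk (Ideal.span {f}) (monomial m (1 : k)) ∈ I) (g : MvPolynomial (Fin n) k)
    (θ : (MvPolynomial (Fin n) k ⧸ Ideal.span {g}) →+* ↥(blowupAlgebra I (Ideal.Quotient.mk (Ideal.span {f}) (monomial m (1 : k)))))
    (hθ : ∀ q : MvPolynomial (Fin n) k, (θ (Ideal.Quotient.mk (Ideal.span {g}) q)).val =
      aeval (fun i : Fin n => algebraMap (MvPolynomial (Fin n) k ⧸ Ideal.span {f})
        (Localization.Away (Ideal.Quotient.mk (Ideal.span {f}) (monomial m (1 : k))))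
        (Ideal.Quotient.mk (Ideal.span {f}) (monomial (a i) (1 : k))) *
        IsLocalization.Away.invSelf (Ideal.Quotient.mk (Ideal.span {f}) (monomial m (1 : k)))) q)
    (K : ℕ) (L NL : List (ℤ × (Fin n → ℕ)))
    (hmem : Ideal.Quotient.mk (Ideal.span {f}) (KLocCellKit.evalL k NL) ∈ I ^ K)
    (hrel : List.Forall₂ (fun t s : ℤ × (Fin n → ℕ) => s.1 = t.1 ∧
      ∀ j : Fin n, (∑ i : Fin n, t.2 i * a i j) + K * m j = s.2 j + (∑ i : Fin n, t.2 i) * m j) L NL) :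
    θ (Ideal.Quotient.mk (Ideal.span {g}) (KLocCellKit.evalL k L)) =
      reesChartEquiv (Ideal.Quotient.mk (Ideal.span {f}) (monomial m (1 : k))) hm
        (HomogeneousLocalization.Away.mk (reesGrading I) (reesT_mem _ hm) K
          ⟨Polynomial.monomial K (Ideal.Quotient.mk (Ideal.span {f}) (KLocCellKit.evalL k NL)),
            reesAlgebra.monomial_mem.mpr hmem⟩
          ⟨Ideal.Quotient.mk (Ideal.span {f}) (KLocCellKit.evalL k NL), by simp⟩) := by
  refine ChartModelNumerators.eq_reesChartEquiv_mk_of_val_eq _ hm K _ hmem _ ?_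
  have hU : IsUnit (algebraMap (MvPolynomial (Fin n) k ⧸ Ideal.span {f})
      (Localization.Away (Ideal.Quotient.mk (Ideal.span {f}) (monomial m (1 : k))))
      (Ideal.Quotient.mk (Ideal.span {f}) (monomial m (1 : k))) ^ K) :=
    (IsLocalization.Away.algebraMap_isUnit (S := Localization.Away (Ideal.Quotient.mk (Ideal.span {f}) (monomial m (1 : k))))
      (Ideal.Quotient.mk (Ideal.span {f}) (monomial m (1 : k)))).pow K
  refine hU.mul_left_injective ?_
  simp only
  unfold KLocCellKit.evalL
  rw [hθ, psi_evalL_mul_pow_of_rel f m a K L NL hrel, mul_assoc, ← mul_pow,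
    mul_comm (IsLocalization.Away.invSelf (Ideal.Quotient.mk (Ideal.span {f}) (monomial m (1 : k)))),
    IsLocalization.Away.mul_invSelf, one_pow, mul_one]

end Summit.ResolutionOfSingularities.ResolutionOfSingularities.Theorems.FInjectiveMacaulayfication.ChartModelReadings

end
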